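import Literature.NumberTheory.GaloisRepresentations.PresentationOfFiniteGaloisModule
import Literature.NumberTheory.GaloisRepresentations.RestrictedRamification
import Literature.Algebra.Homology.DiscreteRepInvariantsQuotient
import HarnessLib

/-!
# The canonical `S`-presentation of a finite Galois module unramified outside `S`:
# `0 → N₁^{N_S} → (ℤ[Γ_K/U_{K(M)}]^{|M|})^{N_S} → M^{N_S} → 0` in `C_{G_S}`

Topic `NumberTheory/GaloisRepresentations`; namespace `Literature.NumberTheory.GaloisRepresentations.FreePresentation`
(sequel to `PresentationOfFiniteGaloisModule`: the canonical presentation `presentationComplex ρ` of a finite discrete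
`Γ_K`-module in `C_{Γ_K}` at the layer `U_{K(M)} = ker ρ`).  Definitions with bodies and theorems; no named fact, no
`sorry`, no instance, no notation.

For the restricted-ramification form of Poitou–Tate (Milne ADT I Thm. 4.10 with `(G_S, E_S, I_S, C_S)`), the presentation
road needs the presentation IN `C_{G_S}` (`G_S = Γ_K ⧸ N_S`, `GaloisGroupUnramifiedOutside K S`) of the `G_S`-module
`M = M^{N_S}` (`M` unramified outside `S`, i.e. `N_S ≤ ker ρ`).  We take the `N_S`-INVARIANTS of the canonical
`Γ_K`-presentation (`DiscreteRep.invariantsQuotD`): since `N_S ≤ ker ρ = U_{K(M)}` acts trivially on all three terms, this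
is again short exact, its third object is DEFINITIONALLY `ofContinuousRep (ρ.quotientInvariants N_S)` — the object whose
continuous cohomology is the tree's `restrictedCohomology ρ S` —, and its inflation back to `Γ_K` is canonically isomorphic
to `presentationComplex ρ` (so a `G_S`-morphism out of it is read through door-c6's `Γ_K`-readouts, brick D4b).

* `presentationComplex_X₂_trivial_of_le` — `N_S ≤ ker ρ` acts trivially on `X₂ = presLattice (K(M)) |M|`;
* **`presentationComplexS ρ S`** `:= (presentationComplex ρ).map (invariantsQuotD ℤ N_S)`,
  **`presentationComplexS_shortExact (hur : N_S ≤ ker ρ)`**, `presentationComplexS_X₃` (`rfl`: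
  `= ofContinuousRep (ρ.quotientInvariants N_S)`), `presentationComplexS_f_injective`, `presentationComplexS_g_surjective`,
  `presentationComplexS_g_apply_coe` (the formula on vectors);
* **`inflPresentationSIso ρ S hur i`** — `Inf_{G_S}^{Γ_K} ((presentationComplexS ρ S).Xᵢ) ≅ (presentationComplex ρ).Xᵢ`
  (`DiscreteRep.inflInvariantsIso`), and the naturality squares with `f`, `g` (`inflQuotFunctor_map_presentationComplexS_f/g`).

HONEST FRAMING: bookkeeping; no case of Poitou–Tate or BSD is proved here.

## References
* J. S. Milne, *Arithmetic Duality Theorems* (2nd ed. 2006), I Lemma 1.9 (proof), I §4 (proof of Thm. 4.10, p. 58). [MilneADT2006]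
* D. Harari, *Galois Cohomology and Class Field Theory* (2020), §4.3 Remark 4.24, Def. 15.36, Remark 17.7 (b). [Harari2020]
* J.-P. Serre, *Galois Cohomology* (1997), I §2.6. [SerreGaloisCohomology1997]
-/

noncomputable section

open CategoryTheory CategoryTheory.Limits
open Field (absoluteGaloisGroup)
open Literature.Algebra.Homology Literature.Algebra.Homology.DiscreteRep
open NumberField IsDedekindDomain

namespace Literature.NumberTheory.GaloisRepresentations

namespace FreePresentation

variable {K : Type} [Field K] [NumberField K]
variable {M : Type} [AddCommGroup M] [TopologicalSpace M] [DiscreteTopology M] [Finite M]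
variable (ρ : DiscreteGaloisModule K M) (S : Set (HeightOneSpectrum (𝓞 K)))

/-! ## §1 `N_S` acts trivially on the canonical `Γ_K`-presentation of a module unramified outside `S` -/

/-- For `N_S ≤ ker ρ`, `N_S ≤ U_{K(M)}` (the open normal subgroup of the splitting layer `K(M)`, `= ker ρ`).
[cite: Harari2020, Def. 15.36, Remark 17.7 (b)] -/
theorem ramificationSubgroup_le_presentationLayer (hur : ramificationSubgroup K S ≤ ContinuousRep.ker ρ) :
    ramificationSubgroup K S ≤ ((presentationLayer ρ).openNormalSubgroup : Subgroup (absoluteGaloisGroup K)) :=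
  fun τ hτ => (mem_presentationLayer_iff ρ τ).2 (by
    have h := (ContinuousRep.mem_ker ρ τ).1 (hur hτ)
    exact LinearMap.ext fun x => LinearMap.congr_fun h x)

/-- **`N_S ≤ ker ρ` acts trivially on `X₂ = presLattice (K(M)) |M|`** of the canonical presentation.
[cite: MilneADT2006, I Lemma 1.9 (proof)] [cite: Harari2020, Remark 17.7 (b)] -/
theorem presentationComplex_X₂_trivial_of_le (hur : ramificationSubgroup K S ≤ ContinuousRep.ker ρ) :
    ∀ τ ∈ ramificationSubgroup K S, ∀ x : (presentationComplex ρ).X₂.obj.V, (presentationComplex ρ).X₂.obj.ρ τ x = x :=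
  fun τ hτ x => trivialOn_presLattice (presentationLayer ρ) (presentationRank ρ) τ
    (ramificationSubgroup_le_presentationLayer ρ S hur hτ) x

/-- `N_S ≤ ker ρ` acts trivially on `X₁ = N₁`. [cite: MilneADT2006, I Lemma 1.9 (proof)] -/
theorem presentationComplex_X₁_trivial_of_le (hur : ramificationSubgroup K S ≤ ContinuousRep.ker ρ) :
    ∀ τ ∈ ramificationSubgroup K S, ∀ x : (presentationComplex ρ).X₁.obj.V, (presentationComplex ρ).X₁.obj.ρ τ x = x :=
  fun τ hτ x => presentationComplex_X₁_trivial ρ τ (ramificationSubgroup_le_presentationLayer ρ S hur hτ) x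

/-- `N_S ≤ ker ρ` acts trivially on `X₃ = M`. [cite: Harari2020, Remark 17.7 (b)] -/
theorem presentationComplex_X₃_trivial_of_le (hur : ramificationSubgroup K S ≤ ContinuousRep.ker ρ) :
    ∀ τ ∈ ramificationSubgroup K S, ∀ x : (presentationComplex ρ).X₃.obj.V, (presentationComplex ρ).X₃.obj.ρ τ x = x :=
  fun τ hτ x => presentationComplex_X₃_trivial ρ τ (ramificationSubgroup_le_presentationLayer ρ S hur hτ) x

/-! ## §2 The `S`-presentation in `C_{G_S}` -/

/-- **The canonical `S`-presentation `0 → N₁^{N_S} → P^{N_S} → M^{N_S} → 0` in `C_{G_S}`**: the `N_S`-invariants of the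
canonical `Γ_K`-presentation `presentationComplex ρ`. [cite: MilneADT2006, I Lemma 1.9 (proof), I §4 (p. 58)]
[cite: Harari2020, §4.3 Remark 4.24] -/
def presentationComplexS : ShortComplex (DiscreteRepCat ℤ (GaloisGroupUnramifiedOutside K S)) :=
  (presentationComplex ρ).map (invariantsQuotD ℤ (ramificationSubgroup K S))

omit [NumberField K] in
/-- `X₃` of the `S`-presentation IS `ofContinuousRep (ρ.quotientInvariants N_S)` — the `G_S`-module `M^{N_S}` whose continuous
cohomology is `restrictedCohomology ρ S` (definitionally). [cite: Harari2020, §17.2 (p. 290)] -/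
theorem presentationComplexS_X₃ [NumberField K] :
    (presentationComplexS ρ S).X₃ = ofContinuousRep (ρ.quotientInvariants (ramificationSubgroup K S)) := rfl

/-- `Xᵢ` of the `S`-presentation is `(Xᵢ)^{N_S}` (definitionally). [cite: Harari2020, §4.3 Remark 4.24] -/
theorem presentationComplexS_X₁ :
    (presentationComplexS ρ S).X₁ = (invariantsQuotD ℤ (ramificationSubgroup K S)).obj (presentationComplex ρ).X₁ := rfl

/-- `X₂` of the `S`-presentation is `(presLattice (K(M)) |M|)^{N_S}` (definitionally). [cite: Harari2020, §4.3 Remark 4.24] -/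
theorem presentationComplexS_X₂ :
    (presentationComplexS ρ S).X₂ =
      (invariantsQuotD ℤ (ramificationSubgroup K S)).obj (presLattice (presentationLayer ρ) (presentationRank ρ)) := rfl

/-- `f`, `g` of the `S`-presentation are the restrictions of `f`, `g` to invariants (definitionally).
[cite: Harari2020, §4.3 Remark 4.24] -/
theorem presentationComplexS_f :
    (presentationComplexS ρ S).f = (invariantsQuotD ℤ (ramificationSubgroup K S)).map (presentationComplex ρ).f := rfl

/-- See `presentationComplexS_f`. [cite: Harari2020, §4.3 Remark 4.24] -/
theorem presentationComplexS_g :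
    (presentationComplexS ρ S).g = (invariantsQuotD ℤ (ramificationSubgroup K S)).map (presentationComplex ρ).g := rfl

/-- Formula on vectors: `((S-presentation).g x).1 = presentationHom ρ x.1` in `M`. [cite: MilneADT2006, I Lemma 1.9 (proof)] -/
theorem presentationComplexS_g_apply_coe (x : ((presentationComplex ρ).X₂.obj.quotientToInvariants (ramificationSubgroup K S)).V) :
    ((presentationComplexS ρ S).g.hom.hom x).1 = (presentationHom ρ).hom.hom x.1 := rfl

/-- **The `S`-presentation is short exact** for `M` unramified outside `S` (`N_S ≤ ker ρ`).
[cite: MilneADT2006, I §4 (proof of Thm. 4.10, p. 58)] [cite: SerreGaloisCohomology1997, I §2.6] -/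
theorem presentationComplexS_shortExact (hur : ramificationSubgroup K S ≤ ContinuousRep.ker ρ) :
    (presentationComplexS ρ S).ShortExact :=
  shortExact_map_invariantsQuotD (ramificationSubgroup K S) (presentationComplex_shortExact ρ)
    (presentationComplex_X₂_trivial_of_le ρ S hur)

/-- `(S-presentation).f` is injective on vectors (`N_S ≤ ker ρ`). [cite: MilneADT2006, I §4 (p. 58)] -/
theorem presentationComplexS_f_injective (hur : ramificationSubgroup K S ≤ ContinuousRep.ker ρ) :
    Function.Injective (presentationComplexS ρ S).f.hom.hom :=
  shortExact_f_injective (presentationComplexS_shortExact ρ S hur)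

/-- `(S-presentation).g` is surjective on vectors (`N_S ≤ ker ρ`). [cite: MilneADT2006, I §4 (p. 58)] -/
theorem presentationComplexS_g_surjective (hur : ramificationSubgroup K S ≤ ContinuousRep.ker ρ) :
    Function.Surjective (presentationComplexS ρ S).g.hom.hom :=
  shortExact_g_surjective (presentationComplexS_shortExact ρ S hur)

/-- A subgroup (here: the `N_S`-invariants) of a `ℤ`-finite object is `ℤ`-finite, for the canonical `ℤ`-module structures
(all `ℤ`-module structures coincide, `moduleFinite_int_iff_of_inst`). [cite: MilneADT2006, I Lemma 1.9 (proof)] -/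
theorem moduleFinite_invariants_of_moduleFinite {Γ : Type} [Group Γ] [TopologicalSpace Γ] (N : Subgroup Γ)
    [N.Normal] (X : DiscreteRepCat ℤ Γ) (hX : @Module.Finite ℤ X.obj.V _ _ (AddCommGroup.toIntModule _)) :
    Module.Finite ℤ (X.obj.quotientToInvariants N).V := by
  refine (moduleFinite_int_iff_of_inst _).2 ?_
  haveI := hX
  haveI : @IsNoetherian ℤ X.obj.V _ _ (AddCommGroup.toIntModule _) :=
    @isNoetherian_of_isNoetherianRing_of_finite ℤ X.obj.V _ _ (AddCommGroup.toIntModule _) _ hX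
  exact Module.Finite.of_injective
    (AddMonoidHom.toIntLinearMap
      ({ toFun := Subtype.val, map_zero' := rfl, map_add' := fun _ _ => rfl } :
        (X.obj.quotientToInvariants N).V →+ X.obj.V))
    (fun a b h => Subtype.ext h)

/-- `X₂` of the `S`-presentation is finitely generated over `ℤ`. [cite: MilneADT2006, I Lemma 1.9 (proof)] -/
theorem moduleFinite_presentationComplexS_X₂ : Module.Finite ℤ (presentationComplexS ρ S).X₂.obj.V :=
  moduleFinite_invariants_of_moduleFinite (ramificationSubgroup K S) (presentationComplex ρ).X₂
    ((moduleFinite_int_iff_of_inst _).1 (moduleFinite_presLattice (presentationLayer ρ) (presentationRank ρ)))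

/-- `X₁` of the `S`-presentation is finitely generated over `ℤ`. [cite: MilneADT2006, I Lemma 1.9 (proof)] -/
theorem moduleFinite_presentationComplexS_X₁ : Module.Finite ℤ (presentationComplexS ρ S).X₁.obj.V := by
  haveI := (presentationComplex_shortExact ρ).mono_f
  have h1 := moduleFinite_of_mono (presentationComplex ρ).f
    (moduleFinite_presLattice (presentationLayer ρ) (presentationRank ρ))
  have e : (presentationComplex ρ).X₁.obj.hV2 = AddCommGroup.toIntModule _ := Subsingleton.elim _ _
  rw [e] at h1
  exact moduleFinite_invariants_of_moduleFinite (ramificationSubgroup K S) (presentationComplex ρ).X₁ h1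

/-! ## §3 Inflating the `S`-presentation back to `Γ_K` -/

/-- **`Inf_{G_S}^{Γ_K} (N₁^{N_S}) ≅ N₁`**, **`Inf (P^{N_S}) ≅ P`**, **`Inf (M^{N_S}) ≅ M`** for `N_S ≤ ker ρ`: the three
counit isomorphisms (`DiscreteRep.inflInvariantsIso`). [cite: SerreGaloisCohomology1997, I §2.6] [cite: Harari2020, §4.3 Remark 4.24] -/
def inflPresentationSIso₁ (hur : ramificationSubgroup K S ≤ ContinuousRep.ker ρ) :
    (inflQuotFunctor ℤ (ramificationSubgroup K S)).obj (presentationComplexS ρ S).X₁ ≅ (presentationComplex ρ).X₁ :=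
  inflInvariantsIso (ramificationSubgroup K S) (presentationComplex ρ).X₁ (presentationComplex_X₁_trivial_of_le ρ S hur)

/-- See `inflPresentationSIso₁`. [cite: SerreGaloisCohomology1997, I §2.6] -/
def inflPresentationSIso₂ (hur : ramificationSubgroup K S ≤ ContinuousRep.ker ρ) :
    (inflQuotFunctor ℤ (ramificationSubgroup K S)).obj (presentationComplexS ρ S).X₂ ≅ (presentationComplex ρ).X₂ :=
  inflInvariantsIso (ramificationSubgroup K S) (presentationComplex ρ).X₂ (presentationComplex_X₂_trivial_of_le ρ S hur)

/-- See `inflPresentationSIso₁`. [cite: SerreGaloisCohomology1997, I §2.6] -/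
def inflPresentationSIso₃ (hur : ramificationSubgroup K S ≤ ContinuousRep.ker ρ) :
    (inflQuotFunctor ℤ (ramificationSubgroup K S)).obj (presentationComplexS ρ S).X₃ ≅ (presentationComplex ρ).X₃ :=
  inflInvariantsIso (ramificationSubgroup K S) (presentationComplex ρ).X₃ (presentationComplex_X₃_trivial_of_le ρ S hur)

/-- Naturality square with `f`: `Inf(f^{N_S}) ≫ e₂.hom = e₁.hom ≫ f`. [cite: Harari2020, §4.3 Remark 4.24] -/
theorem inflQuotFunctor_map_presentationComplexS_f (hur : ramificationSubgroup K S ≤ ContinuousRep.ker ρ) :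
    (inflQuotFunctor ℤ (ramificationSubgroup K S)).map (presentationComplexS ρ S).f ≫ (inflPresentationSIso₂ ρ S hur).hom =
      (inflPresentationSIso₁ ρ S hur).hom ≫ (presentationComplex ρ).f :=
  invariantsInclQuot_naturality (ramificationSubgroup K S) (presentationComplex ρ).f

/-- Naturality square with `g`: `Inf(g^{N_S}) ≫ e₃.hom = e₂.hom ≫ g`. [cite: Harari2020, §4.3 Remark 4.24] -/
theorem inflQuotFunctor_map_presentationComplexS_g (hur : ramificationSubgroup K S ≤ ContinuousRep.ker ρ) :
    (inflQuotFunctor ℤ (ramificationSubgroup K S)).map (presentationComplexS ρ S).g ≫ (inflPresentationSIso₃ ρ S hur).hom =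
      (inflPresentationSIso₂ ρ S hur).hom ≫ (presentationComplex ρ).g :=
  invariantsInclQuot_naturality (ramificationSubgroup K S) (presentationComplex ρ).g

/-- **A `G_S`-morphism `h : (S-presentation).X₁ ⟶ Y` read on `Γ_K`**: `e₁.inv ≫ Inf(h) : N₁ ⟶ Inf Y` (the shape door-c6's
`Γ_K`-readouts consume, brick D4b). [cite: MilneADT2006, I §4 (proof of Thm. 4.10, p. 58)] -/
def inflHomX₁ (hur : ramificationSubgroup K S ≤ ContinuousRep.ker ρ) {Y : DiscreteRepCat ℤ (GaloisGroupUnramifiedOutside K S)}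
    (h : (presentationComplexS ρ S).X₁ ⟶ Y) :
    (presentationComplex ρ).X₁ ⟶ (inflQuotFunctor ℤ (ramificationSubgroup K S)).obj Y :=
  (inflPresentationSIso₁ ρ S hur).inv ≫ (inflQuotFunctor ℤ (ramificationSubgroup K S)).map h

/-- `inflHomX₁` is additive in `h`. [cite: MilneADT2006, I §4 (p. 58)] -/
theorem inflHomX₁_add (hur : ramificationSubgroup K S ≤ ContinuousRep.ker ρ)
    {Y : DiscreteRepCat ℤ (GaloisGroupUnramifiedOutside K S)} (h h' : (presentationComplexS ρ S).X₁ ⟶ Y) :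
    inflHomX₁ ρ S hur (h + h') = inflHomX₁ ρ S hur h + inflHomX₁ ρ S hur h' := by
  rw [inflHomX₁, inflHomX₁, inflHomX₁, Functor.map_add, Preadditive.comp_add]

/-- `inflHomX₁` is injective (inflation is faithful, `e₁` an isomorphism). [cite: Harari2020, §4.3 Remark 4.24] -/
theorem inflHomX₁_injective (hur : ramificationSubgroup K S ≤ ContinuousRep.ker ρ)
    {Y : DiscreteRepCat ℤ (GaloisGroupUnramifiedOutside K S)} :
    Function.Injective (inflHomX₁ ρ S hur (Y := Y)) := fun h h' e => by
  haveI := inflQuotFunctor_faithful (k := ℤ) (ramificationSubgroup K S)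
  have e' : (inflQuotFunctor ℤ (ramificationSubgroup K S)).map h = (inflQuotFunctor ℤ (ramificationSubgroup K S)).map h' := by
    simpa [inflHomX₁] using e
  exact (inflQuotFunctor ℤ (ramificationSubgroup K S)).map_injective e'

/-- Formula: `(inflHomX₁ h) x = h ⟨x, _⟩` on vectors. [cite: MilneADT2006, I §4 (p. 58)] -/
theorem inflHomX₁_hom_hom_apply (hur : ramificationSubgroup K S ≤ ContinuousRep.ker ρ)
    {Y : DiscreteRepCat ℤ (GaloisGroupUnramifiedOutside K S)} (h : (presentationComplexS ρ S).X₁ ⟶ Y)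
    (x : (presentationComplex ρ).X₁.obj.V) :
    (inflHomX₁ ρ S hur h).hom.hom x =
      h.hom.hom ⟨x, fun τ => presentationComplex_X₁_trivial_of_le ρ S hur τ.1 τ.2 x⟩ := by
  change ((inflQuotFunctor ℤ (ramificationSubgroup K S)).map h).hom.hom ((inflPresentationSIso₁ ρ S hur).inv.hom.hom x) = _
  rw [inflQuotFunctor_map_hom_hom]
  congr 1
  apply Subtype.ext
  exact invariantsInclQuot_inflInvariantsIso_inv_apply (ramificationSubgroup K S) (presentationComplex ρ).X₁
    (presentationComplex_X₁_trivial_of_le ρ S hur) x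

end FreePresentation

end Literature.NumberTheory.GaloisRepresentations
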